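import Summits.ResolutionOfSingularities.ResolutionOfSingularities.Theses.WeightedInvariant
import Literature.AlgebraicGeometry.Resolution.ResolutionProjectiveReduction
import Literature.AlgebraicGeometry.Resolution.AlterationsStrong
import Literature.AlgebraicGeometry.Resolution.FiniteBirationalNormal
import Literature.AlgebraicGeometry.Resolution.KedlayaEtaleCovers
import Literature.AlgebraicGeometry.Resolution.QuasiProjectiveResolution
import Literature.AlgebraicGeometry.Motives.VarietiesProjectiveSpaceProofs
import Literature.AlgebraicGeometry.Motives.ProjectiveLineInvolution
import Literature.AlgebraicGeometry.Motives.ProjectiveSpaceFunctionField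
import Literature.AlgebraicGeometry.Motives.CartierDivisor
import Summits.ResolutionOfSingularities.ResolutionOfSingularities.Theorems.WeightedInvariantWeightedThesisProjectiveIntegralSuffices
import Summits.ResolutionOfSingularities.ResolutionOfSingularities.Theorems.WeightedInvariantWeightedThesisFiniteBirationalTransfer
import Summits.ResolutionOfSingularities.ResolutionOfSingularities.Theorems.WeightedInvariantWeightedThesisHypersurfaceModelInfinite
import Summits.ResolutionOfSingularities.ResolutionOfSingularities.Theorems.WeightedInvariantWeightedThesisGraphClosure
import Summits.ResolutionOfSingularities.ResolutionOfSingularities.Theorems.WeightedInvariantWeightedThesisImageLocallyPrincipal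
import Summits.ResolutionOfSingularities.ResolutionOfSingularities.Theorems.WeightedInvariantWeightedThesisSeparableProjectionOfKedlaya
import Summits.ResolutionOfSingularities.ResolutionOfSingularities.Theorems.WeightedInvariantWeightedThesisFiniteFieldBranch
import Summits.ResolutionOfSingularities.ResolutionOfSingularities.Theorems.WeightedInvariantWeightedThesisSeparableProjection
import Summits.ResolutionOfSingularities.ResolutionOfSingularities.Theorems.WeightedInvariantDatumToEmbedded
import Summits.ResolutionOfSingularities.ResolutionOfSingularities.Theorems.WeightedInvariantWeightedThesisBerghRydhCharP
import Summits.ResolutionOfSingularities.ResolutionOfSingularities.Theorems.WeightedInvariantWeightedThesisHypersurfaceTower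
import Summits.ResolutionOfSingularities.ResolutionOfSingularities.Theorems.WeightedInvariantWeightedThesisHypersurfaceStrategyAssembly
import Summits.ResolutionOfSingularities.ResolutionOfSingularities.Theorems.WeightedInvariantWeightedThesisHypersurfaceRatedRuleStrategy
import Summits.ResolutionOfSingularities.ResolutionOfSingularities.Theorems.WeightedInvariantWeightedThesisHypersurfaceChoice
import Summits.ResolutionOfSingularities.ResolutionOfSingularities.Theorems.WeightedInvariantWeightedThesisHypersurfaceChoiceTower
import Summits.ResolutionOfSingularities.ResolutionOfSingularities.Theorems.WeightedInvariantWeightedThesisHypersurfaceChoiceDim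
import Summits.ResolutionOfSingularities.ResolutionOfSingularities.Theorems.WeightedInvariantWeightedThesisHypersurfaceChoiceDimTower
import Summits.ResolutionOfSingularities.ResolutionOfSingularities.Theorems.WeightedInvariantWeightedThesisHypersurfaceChoiceDimZero
import Summits.ResolutionOfSingularities.ResolutionOfSingularities.Theorems.WeightedInvariantWeightedThesisHypersurfaceChoiceT
import Summits.ResolutionOfSingularities.ResolutionOfSingularities.Theorems.WeightedInvariantWeightedThesisHypersurfaceChoiceTChart
import Summits.ResolutionOfSingularities.ResolutionOfSingularities.Theorems.WeightedInvariantWeightedThesisHypersurfaceChoiceTAtlas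
import Summits.ResolutionOfSingularities.ResolutionOfSingularities.Theorems.WeightedInvariantWeightedThesisHypersurfaceChoiceTTower
import Summits.ResolutionOfSingularities.ResolutionOfSingularities.Theorems.WeightedInvariantWeightedThesisHypersurfaceTowerChoice
import Summits.ResolutionOfSingularities.ResolutionOfSingularities.Theorems.WeightedInvariantWeightedThesisHypersurfaceTowerChoiceTower
import Literature.AlgebraicGeometry.Resolution.ResolutionOfComponents
import Mathlib.AlgebraicGeometry.Morphisms.ClosedImmersion
import Mathlib.AlgebraicGeometry.Morphisms.Finite
import Mathlib.AlgebraicGeometry.Morphisms.Smooth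

/-!
# Crux `WeightedThesis` (stmt-ResolutionOfSingularities-0569) — line `datum-glued-split`

LEAD SKELETON, RESHAPE 9 (prover-line-stmt-ResolutionOfSingularities-0569-c9, 2026-08-17; RESHAPE 8 of lead c8 with the
construction stub WEAKENED a third time, from a hypersurface centre STRATEGY (functorial for smooth surjections between
pairs) to a hypersurface centre CHOICE (pair by pair: regular weighted centre, generic point off the support,
homogeneity on every torus chart of the pair, termination of the global cobordant tower; NO functoriality) — see
"Lead c9" below).

The crux is the route's rank-0 TARGET: resolution of every reduced separated scheme of finite type
over every PERFECT field of characteristic `p`, for every prime `p` — the resolution conjecture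
over perfect fields (Disproof.lean v1.2: faithful, every hypothesis load-bearing, minimal
counterexample = integral closed `X ⊆ ℙⁿ_k` of dimension `≥ 4`; `-- Targets`: none).

History. Cycle 1 (lead 0) built `WeightedThesis ⇐ WeightedConstruction ∧ DatumToEmbedded` through
the tree's projective reduction (stub 3 `ProjectiveIntegralSuffices` p86611, `ZeroStep` p87961).
RESHAPE 2 (lead 1) shrank the second input to HYPERSURFACES: the crux is WEAK and ABSOLUTE
(`Scheme.HasResolution X` = some proper birational regular `X̃ → X`) and `k` is PERFECT, so an
integral projective `X` may be replaced by an integral hypersurface `H` of a smooth ambient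
receiving a finite birational `X → H`, along which resolutions transfer (stub 4, p98340). RESHAPE 3
(lead a1) closed the hypersurface models over INFINITE perfect fields (generic linear projection
to `ℙ^{d+1} ∖ {vertex}`; stubs F1/F2/F3 + glue + `stub_hypersurfaceModel_infinite`, p140311,
p140495, p140445, p140353, p140615 — all LANDED). RESHAPE 4 (lead a1) closed the FINITE ground
fields by hypersurface models up to a proper birational modification (separable projective Noether
normalisation `stub_separableProjection` p142347 + p142892, graph closure `stub_graphClosure`
p141770, `stub_imageLocallyPrincipal` p141747, assembly `stub_finiteFieldBranch_of_parts` p142081),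
leaving exactly two sorries: `stub_weightedConstruction` (= item stmt-0571) and
`stub_datumToHypersurfaceNonminimal` (≤ item stmt-0572).

RESHAPE 5 (this file). Meanwhile crux stmt-0572 `DatumToEmbedded` LANDED modulo one named published
fact (`Theorems/WeightedInvariantDatumToEmbedded.lean`, p129265:
`datumToEmbedded_of_berghRydh2019 : BerghRydh2019_diagonalizableQuotientResolution → DatumToEmbedded`,
Włodarczyk's global cobordant tower + graded torus-quotient atlases + Luna slice, the quotient of each
cobordant blow-up realised as a blow-up downstairs; the fact is Bergh–Rydh arXiv:1905.00872 Thm 5 in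
its diagonalizable étale-local form, `Literature/…/TameQuotientSingularitiesResolution.lean`). So stub
2' is now a THEOREM of this file, derived from the new registered stub

* `stub_berghRydh2019 : BerghRydh2019_diagonalizableQuotientResolution` — a NAMED PUBLISHED FACT
  (resolution of finite diagonalizable quotient singularities over perfect fields; its discharge is a
  formalisation of tame destackification / toroidal resolution of simplicial toric singularities,
  crux-sized, shared verbatim with the registered skeleton of crux stmt-0572, line `Sketch`)
  — since RESHAPE 6 (lead c6) replaced by its characteristic-`p` instances `stub_berghRydh2019_charP`, and

* `stub_weightedConstruction : WeightedConstruction` — crux item stmt-0571 BY NAME: THE research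
  obstruction (a weighted resolution datum exists in every prime characteristic; open,
  Abramovich–Temkin–Włodarczyk 2024 §1.9); worked by its own seats, not waved.

Every other stub of RESHAPEs 1–4 is LANDED and appears below with its tree proof. The skeleton
closes `WeightedThesis` BY NAME modulo exactly these two sorries; the same residue is landed in the
tree WITHOUT the hypersurface detour as `Theorems/WeightedInvariantWeightedThesisOfBerghRydh.lean`
(`weightedThesis_of_berghRydh2019 : BerghRydh2019_… → WeightedConstruction → WeightedThesis`, lead
c4). The hypersurface composition is kept as the line's composition because it records the WEAKER
need: a datum is consumed only on pairs `(Y, H)` with `H` an integral hypersurface (locally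
principal ideal) of a smooth separated quasi-compact — indeed smooth quasi-projective — `Y`.

Lead c5 (2026-08-17). No provable stub is left: the two sorries are an existing crux item (stmt-0571,
the open problem) and a crux-sized named published fact; wave: none. The datum-free by-product of the
line is landed as `Theorems/WeightedInvariantWeightedThesisHypersurfacesIff.lean` (p148806, registered
stubs `weightedThesis_iff_hypersurfaces` — `WeightedThesis` ⟺ resolution of integral HYPERSURFACES of
smooth separated quasi-compact schemes over perfect fields of characteristic `p`, the statement of crux
idea `codimension-one-suffices` — and `weightedThesis_iff_hypersurfaces_of_dim`, the same for
hypersurfaces of dimension `> 3` modulo `CossartPiltant2019`). The crux is pinned on stmt-0571.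

Lead c6 (2026-08-17), RESHAPE 6. The named-fact stub is cut down to what the composition consumes: Bergh–Rydh
2019 Thm 5 over the perfect fields OF CHARACTERISTIC `p` only (`stub_berghRydh2019_charP`, registered; implied
verbatim by the recorded fact `BerghRydh2019_diagonalizableQuotientResolution`, which quantifies over all perfect
fields, characteristic `0` included). The tower of crux 0572 is re-run field-wise in the landed
`Theorems/WeightedInvariantWeightedThesisBerghRydhCharP.lean` (p151492, registered stubs
`resolution_field_iff_berghRydh_field_of_datum`, `weightedThesis_iff_forall_berghRydh_charP`): GIVEN a datum at
`p = char k`, resolution over the perfect field `k` is EQUIVALENT to Bergh–Rydh over `k`, and granted stmt-0571 the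
crux is EQUIVALENT to `stub_berghRydh2019_charP` — Hironaka-free (c4's `weightedThesis_iff_berghRydh2019` needed
`Hironaka1964` for the characteristic-`0` instances of the recorded fact). So the two remaining sorries are now
exactly {stmt-0571, the characteristic-`p` half of a published theorem}, and the second is implied by the crux
itself. wave: none (stmt-0571 has its own chain; the Bergh–Rydh instances are a crux-sized formalisation).

Lead c7 (2026-08-17), RESHAPE 7 — door (α) of the construction crux's strategy census
(`Cruxes/WeightedConstruction/STRATEGY-CENSUS.md` §6; lead c5's recommendation). The composition consumes a
datum ONLY on integral hypersurface pairs, and the cobordant tower never leaves that class. So the first stub is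
weakened from `WeightedConstruction` (= item stmt-0571: a datum with axioms on ALL ideal sheaves) to
`stub_hypersurfaceConstruction : ∀ p prime, Nonempty (HypersurfaceResolutionDatum p)` — the datum interface with
every axiom demanded only for `X` locally principal with integral subscheme
(`Theorems/WeightedInvariantWeightedThesisHypersurfaceDatum.lean`, p154446; `HypersurfaceResolutionDatum.ofDatum`
makes stmt-0571 imply it). The whole tower was re-run for this interface and LANDED: hypersurfaces are preserved
by the global cobordant blow-up (`…HypersurfacePreserved`, p154794: stalks of the regular `B` are UFDs, the
saturation of a principal ideal by a principal ideal is principal); the datum-free tower lemmas for an arbitrary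
regular weighted centre (`…TowerGenericAmbient` p154981, `…TowerGenericQuotient` p155604); the engine, axiom `(ii)`
and the generic point off the centre (`…HypersurfaceTowerRegular`, p155361); homogeneity of the centre and the
drop for the hypersurface datum (`…HypersurfaceTowerStep`, p155770); and the assembly
(`…HypersurfaceTower`: `weightedThesis_of_hypersurfaceConstruction_of_forall_berghRydh_charP`, field-wise
`resolution_field_iff_berghRydh_field_of_hypersurfaceDatum`). The skeleton closes `WeightedThesis` BY NAME modulo
{`stub_hypersurfaceConstruction`, `stub_berghRydh2019_charP`}; the first is NOT an existing item — it is the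
typed, consumer-proved restatement target for stmt-0571 (handed to the planner: promote-stub), strictly weaker
than stmt-0571 (`stub_hypersurfaceConstruction_of_weightedConstruction`).

Lead c8 (2026-08-17), RESHAPE 8 — the STRATEGY door (δ), completing census door (γ) from the consumer side.
Reading the RESHAPE 7 tower shows that its induction consumes the hypersurface datum ONLY through: the centre
of a SINGULAR integral hypersurface pair is a regular weighted centre (`(iii)`, first half); the generic point
of the hypersurface is off the centre (`(ii)`+`(iii)`); the centre is functorial for smooth surjective
`k`-morphisms (homogeneity on torus charts); and the tower of global cobordant blow-ups
`(Y, X) ↦ (B₊, σˢ(X)|_{B₊})` STOPS — the one well-order `Γ`, the invariant `inv`, `(usc)`, `(i)` for `inv`,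
base change and the pointwise drop `(iv)` enter only the proof of termination. So the first stub is weakened
again, from `∀ p, Nonempty (HypersurfaceResolutionDatum p)` (13 fields) to
`stub_hypersurfaceStrategy : ∀ p prime, Nonempty (HypersurfaceCentreStrategy p)` (5 fields: `centre`,
`isRegularWeightedCentre_centre`, `genericPoint_not_mem_support_centre`, `centre_comap` for smooth surjections,
`wellFounded_step : WellFounded (HypersurfacePair.Step centre)` over every perfect field of characteristic `p`;
`Theorems/WeightedInvariantWeightedThesisHypersurfaceStrategy.lean`). The tower was re-run by well-founded
induction on the tower-step relation itself (`Theorems/…HypersurfaceStrategyTower.lean` + `…HypersurfaceStrategyAssembly.lean`: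
`HypersurfaceStrategyTower.hasResolution_quotient_of_gradedAtlas`, homogeneity
`centre_isHomogeneous_of_strategy`, field-wise `resolution_field_iff_berghRydh_field_of_strategy`, the
composition `weightedThesis_of_hypersurfaceStrategy_of_forall_berghRydh_charP`), and every hypersurface datum
is a strategy (`hyp_nonempty_strategy_of_hypersurfaceDatum`: termination by the drop of `max inv`), so
stmt-0571 ⇒ RESHAPE 7's stub ⇒ RESHAPE 8's stub (`stub_hypersurfaceStrategy_of_hypersurfaceConstruction`,
`…_of_weightedConstruction`). What the constructor is spared: ONE well-order across all dimensions (which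
excludes the `∞`-lex profile invariants of ATW/AQS a priori — the 0571 line's `stub_recoding`), upper
semicontinuity (the only recorded cause of death of the root/Diff-tower rule, TOWER-CENSUS-c5), base change,
and the pointwise drop — only ITS OWN tower has to stop. The skeleton closes `WeightedThesis` BY NAME modulo
{`stub_hypersurfaceStrategy`, `stub_berghRydh2019_charP`}; the first is the typed, consumer-proved restatement
target for stmt-0571 (promote-stub), the second is implied by the crux (unchanged). Door (γ) is ALSO landed
as a typed intermediate object: `HypersurfaceRatedRule p` (`Theorems/…HypersurfaceRatedRule.lean`: an invariant into
a LINEAR order with finitely many values per pair, `(i)`, `(ii')`, `(iii)`, chartwise drop `(iv)`, and well-orderedness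
of the values met along the towers of ONE pair — no global well-order, no `(usc)`) with
`hyp_nonempty_strategy_of_ratedRule` (`Theorems/…HypersurfaceRatedRuleStrategy.lean`: chartwise drop ⇒ global drop of
`max inv` ⇒ accessibility of every pair); so the planner has three consumer-proved restatement targets for stmt-0571
of decreasing strength: hypersurface datum ⇒ rated rule ⇒ strategy.

Lead c9 (2026-08-17), RESHAPE 9 — the CHOICE door ((β)/(ε) of the 0571 strategist's census
`Cruxes/WeightedConstruction/STRATEGY-CENSUS.md` §6(β) "bare vs equivariant", `NEGATIVE-c4.md` §3 "the torus belongs in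
the state", in the form the tower can consume today). Reading the RESHAPE 8 tower shows that the strategy's functoriality
`(i)` for smooth surjections BETWEEN pairs is read at exactly one place — `centre_isHomogeneous_of_strategy`, the
homogeneity of the centre for the torus-chart gradings of the CURRENT pair. So the first stub is weakened again, from
`∀ p, Nonempty (HypersurfaceCentreStrategy p)` to `stub_hypersurfaceChoice : ∀ p prime, Nonempty (HypersurfaceCentreChoice p)`
(`Theorems/WeightedInvariantWeightedThesisHypersurfaceChoice.lean`, p165126: `centre`, `(iii)` regular weighted centre,
`(ii')` generic point off the support, `(H)` homogeneity for every `ℤʲ`-grading of every affine open of the pair with the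
constants in degree `0` and the hypersurface ideal homogeneous, `(T)` well-founded tower step — and NO axiom relating the
centres of two different pairs: the centre may be CHOSEN pair by pair, even non-canonically; only the towers of these
choices must stop). The tower was re-run reading `(H)` directly (`Theorems/…HypersurfaceChoiceTower.lean`:
`HypersurfaceChoiceTower.hasResolution_quotient_of_gradedAtlas`, field-wise `resolution_field_iff_berghRydh_field_of_choice`,
the composition `weightedThesis_of_hypersurfaceChoice_of_forall_berghRydh_charP`), and every strategy is a choice
(`HypersurfaceCentreChoice.ofStrategy`, `(H)` = `hyp_centre_isHomogeneous_of_hypersurfaceStrategy`), so stmt-0571 ⇒ RESHAPE 7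
⇒ RESHAPE 8 ⇒ RESHAPE 9 (`stub_hypersurfaceChoice_of_hypersurfaceStrategy`, `…_of_hypersurfaceConstruction`,
`…_of_weightedConstruction`). This is the FLOOR of the consumer side: each of `(iii)` (smoothness of `B₊`), `(ii')`
(birationality), `(H)` (the torus action on `B₊` and the quotient step) and `(T)` (induction) is read by the tower. What
the constructor is spared beyond RESHAPE 8: any relation between different pairs — uniformity, canonicity, functoriality;
the door is "non-functorial embedded weighted resolution of hypersurfaces in characteristic `p`, torus-equivariant along
its own towers". The skeleton closes `WeightedThesis` BY NAME modulo {`stub_hypersurfaceChoice`, `stub_berghRydh2019_charP`};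
the first is the typed, consumer-proved restatement target for stmt-0571 (promote-stub), the second is implied by the crux
(unchanged).

Disproof.lean (v1.2) honoured: `IsReduced`/`LocallyOfFiniteType` are consumed inside stub 3,
`[PerfectField k]` is consumed four times (datum axioms; Bergh–Rydh; separability of `K(X)/k` in
both branches; primitive element in the finite branch), `CharP k p` by the degrees prime to `p`.
-/

noncomputable section

set_option linter.dupNamespace false

open CategoryTheory CategoryTheory.Limits AlgebraicGeometry
open Literature.AlgebraicGeometry.Resolution
open Summit.ResolutionOfSingularities.ResolutionOfSingularities.Theses.WeightedInvariant

namespace Summit.ResolutionOfSingularities.ResolutionOfSingularities.Cruxes.WeightedThesis.Lines.DatumGluedSplit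

/-! ## The stubs -/

/-- STUB τ (RESHAPE 11) — **TOWER-INDEXED hypersurface centre choices by transversal dimension — the torus in the STATE**: for every
prime `p` and every `e : ℕ` a `HypersurfaceTowerChoiceDim p e` exists
(`Theorems/WeightedInvariantWeightedThesisHypersurfaceTowerChoice.lean`, p169414: a weighted centre `centre τ : ReesAlgebraData P.Y` for every
cobordant TOWER `τ : HypersurfacePair.Tower P` — tower DATA: the empty tower, or a prefix followed by the global cobordant blow-up of a Rees
filtration on the prefix's ambient with the strict transform — such that, over every perfect field of characteristic `p`, for every RUN `τ` of
`centre` (`Tower.IsRun`: each step blew up the centre prescribed for its singular prefix) STARTED at a pair whose integral hypersurface has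
dimension `e` and ENDING at a pair whose hypersurface is not regular: `(iii)` `centre τ` is a regular weighted centre, `(ii')` the generic
point of the hypersurface is off its support, `(H_τ)` every piece of `centre τ` is homogeneous on every chart `(W, 𝒢)` OF THE TOWER
(`Tower.IsChart`: the trivial `ℤ⁰`-grading of any affine open for the empty tower; a `TowerChartStep` — transport to a localisation of
Włodarczyk's extended Rees algebra, bigrading pinned on ring generators `t⁻¹ ↦ (0,−1)`, `s ↦ (χ,0)`, `x tⁿ ↦ (χ,n)` — over a chart of the
prefix for each step; so: the `𝔾ₘ^{rank τ}`-gradings of THIS tower) on which the hypersurface ideal is homogeneous, and `(T)` "extend a run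
started in dimension `e` by its prescribed step" is well-founded on `Σ P, Tower P`). The centre may thus be read off the whole history —
in particular off the torus of the tower, which is what a `T`-equivariant construction needs and what no pair-indexed interface can offer
(the same scheme could a priori end two towers with two tori). The most permissive door of the line and the floor of the consumer side:
`(iii)` is read by the smoothness of `B₊`, `(ii')` by birationality, `(H_τ)` by the torus action on `B₊` and the quotient step — on exactly
these charts (`HypersurfaceTowerChoiceTower.hasResolution_quotient_of_gradedAtlas`: the tower run ON TOWER DATA, its atlases consisting of
charts of the tower) — `(T)` by the induction. Implied by RESHAPE 10's ladder (`stub_hypersurfaceTowerChoiceDim_of_hypersurfaceChoiceTDim`: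
`ofChoiceTDim`), hence by every earlier door (tower-typed ladder ⟸ `(H)`-ladder ⟸ choice ⟸ strategy ⟸ rated rule ⟸ hypersurface datum
⟸ crux item stmt-0571); rung `e = 0` PROVED (`hyp_nonempty_towerChoiceDim_zero`); rung `e = 1` IS Abramovich–Quek–Schober arXiv:2507.01232
Thm 1.1 up to language only (their `(𝒲 ⊃ 𝒵, T = 𝔾ₘⁿ)` with finite stabilisers = the end of a run of rank `n` started at a curve on a smooth
surface; their unique `T`-invariant centre `(x₁^{a₁}, x₂^{a₂})` of maximal invariant along a singular closed orbit = a centre homogeneous on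
the charts of the run; their `𝒲' = B₊`, `T' = T × 𝔾ₘ` = the extended run; their finite termination = `(T)`) — printed, arbitrary field;
`e = 2` equivariant Cossart–Jannsen–Saito, not in print; `e ≥ 3` open (Abramovich–Temkin–Włodarczyk 2024 §1.9). NOT an item: handed to the
planner as the typed door (β) of `Cruxes/WeightedConstruction/STRATEGY-CENSUS.md` §6 in full, with a calibration ladder (promote-stub).
[conjecture — AbramovichTemkinWlodarczyk2024 §1.9 poses the construction] -/
theorem stub_hypersurfaceTowerChoiceDim :
    ∀ p : ℕ, p.Prime → ∀ e : ℕ, Nonempty (Summit.ResolutionOfSingularities.ResolutionOfSingularities.Theorems.HypersurfaceTowerChoiceDim p e) := by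
  sorry




/-! ### RESHAPE 9 (lead c9): the CHOICE door — functoriality `(i)` replaced by torus-homogeneity `(H)` -/

/-- PORT (RESHAPE 9) — **the centre of a strategy is homogeneous on every torus chart of a singular hypersurface pair**:
property `(H)` of the choice interface for a STRATEGY — the whole content of "strategy ⇒ choice" (`(i)` along
`act ⊔ 𝟙_Y, pr ⊔ 𝟙_Y : T ⊔ Y → Y`, c8's `centre_isHomogeneous_of_strategy`, the one place where the RESHAPE 8 tower read
`(i)`) — LANDED with the RESHAPE 9 objects file `Theorems/WeightedInvariantWeightedThesisHypersurfaceChoice.lean` (p165126).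
[cite: Wlodarczyk2022, Thm. 1.1.4 (6)] -/
theorem hyp_centre_isHomogeneous_of_hypersurfaceStrategy : ∀ {p : ℕ} (S : Summit.ResolutionOfSingularities.ResolutionOfSingularities.Theorems.HypersurfaceCentreStrategy p) {k : Type} [Field k] [CharP k p] [PerfectField k] {Y : AlgebraicGeometry.Scheme.{0}} (f : Y ⟶ AlgebraicGeometry.Spec (.of k)) [AlgebraicGeometry.Smooth f] [AlgebraicGeometry.IsSeparated f] [AlgebraicGeometry.QuasiCompact f] (X : Y.IdealSheafData), Literature.AlgebraicGeometry.Resolution.IsLocallyPrincipal X → AlgebraicGeometry.IsIntegral X.subscheme → ¬ Literature.AlgebraicGeometry.Resolution.Scheme.IsRegular X.subscheme → ∀ {j : ℕ} (W : Y.affineOpens) (𝒢 : (Fin j → ℤ) → AddSubgroup Γ(Y, W)) [GradedRing 𝒢], (∀ c : Γ(AlgebraicGeometry.Spec (.of k), ⊤), f.appLE ⊤ W le_top c ∈ 𝒢 0) → (X.ideal W).IsHomogeneous 𝒢 → ∀ n : ℕ, (((S.centre f X).piece n).ideal W).IsHomogeneous 𝒢 :=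
  fun S _ _ _ _ _ f _ _ _ X hX hXi hsing _ W 𝒢 _ h0 hXhom n =>
    Summit.ResolutionOfSingularities.ResolutionOfSingularities.Theorems.hyp_centre_isHomogeneous_of_hypersurfaceStrategy S f X hX hXi hsing W 𝒢 h0 hXhom n


/-- RESHAPE 8's stub S (`∀ p, Nonempty (HypersurfaceCentreStrategy p)`) implies stub C: every strategy is a choice
(`HypersurfaceCentreChoice.ofStrategy`, LANDED p165126). [folklore] -/
theorem stub_hypersurfaceChoice_of_hypersurfaceStrategy
    (hS : ∀ p : ℕ, p.Prime → Nonempty (Summit.ResolutionOfSingularities.ResolutionOfSingularities.Theorems.HypersurfaceCentreStrategy p)) :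
    ∀ p : ℕ, p.Prime → Nonempty (Summit.ResolutionOfSingularities.ResolutionOfSingularities.Theorems.HypersurfaceCentreChoice p) :=
  fun p hp => Summit.ResolutionOfSingularities.ResolutionOfSingularities.Theorems.HypersurfaceCentreChoice.nonempty_of_nonempty_strategy (hS p hp)

/-- RESHAPE 7's stub H (`∀ p, Nonempty (HypersurfaceResolutionDatum p)`) implies stub C (datum ⇒ strategy ⇒ choice). [folklore] -/
theorem stub_hypersurfaceChoice_of_hypersurfaceConstruction
    (hH : ∀ p : ℕ, p.Prime → Nonempty (Summit.ResolutionOfSingularities.ResolutionOfSingularities.Theorems.HypersurfaceResolutionDatum p)) :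
    ∀ p : ℕ, p.Prime → Nonempty (Summit.ResolutionOfSingularities.ResolutionOfSingularities.Theorems.HypersurfaceCentreChoice p) :=
  fun p hp => Summit.ResolutionOfSingularities.ResolutionOfSingularities.Theorems.HypersurfaceCentreChoice.nonempty_of_hypersurfaceDatum
    (Classical.choice (hH p hp))

/-- Item stmt-0571 `WeightedConstruction` implies stub C (datum ⇒ hypersurface datum ⇒ strategy ⇒ choice): RESHAPE 9 weakens the
line's first input a third time. [folklore] -/
theorem stub_hypersurfaceChoice_of_weightedConstruction (hC : WeightedConstruction) :
    ∀ p : ℕ, p.Prime → Nonempty (Summit.ResolutionOfSingularities.ResolutionOfSingularities.Theorems.HypersurfaceCentreChoice p) :=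
  fun p hp => Summit.ResolutionOfSingularities.ResolutionOfSingularities.Theorems.HypersurfaceCentreChoice.nonempty_of_nonempty_datum (hC p hp)

/-! ### RESHAPE 9 (lead c9), second half: the choice door as a LADDER indexed by transversal dimension -/

/-- PORT (RESHAPE 9, ladder) — **the hypersurface of a closed immersion has a natural-number dimension** (where every
cobordant tower STARTS: the transversal dimension of the ladder) — LANDED with the ladder objects file
`Theorems/WeightedInvariantWeightedThesisHypersurfaceChoiceDim.lean` (p166405). [folklore] -/
theorem hyp_exists_nat_topologicalKrullDim_ker_subscheme : ∀ {k : Type} [Field k] {Y X : AlgebraicGeometry.Scheme.{0}} (f : Y ⟶ AlgebraicGeometry.Spec (.of k)) [AlgebraicGeometry.LocallyOfFiniteType f] [AlgebraicGeometry.QuasiCompact f] (i : X ⟶ Y) [AlgebraicGeometry.IsClosedImmersion i] [AlgebraicGeometry.IsIntegral X], ∃ e : ℕ, topologicalKrullDim ↥(AlgebraicGeometry.Scheme.Hom.ker i).subscheme = (e : WithBot ℕ∞) :=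
  fun f _ _ i _ _ => Summit.ResolutionOfSingularities.ResolutionOfSingularities.Theorems.hyp_exists_nat_topologicalKrullDim_ker_subscheme f i


/-- PORT (RESHAPE 9, ladder) — **the bottom rung is inhabited**: `HypersurfaceCentreChoiceDim p 0` for every `p` (a
`0`-dimensional integral hypersurface is a reduced point, regular — `isRegular_of_topologicalKrullDim_eq_zero` — so no tower step
leaves it and every obligation, guarded by non-regularity of a pair reached from it, is vacuous) — LANDED
(`Theorems/WeightedInvariantWeightedThesisHypersurfaceChoiceDimZero.lean`, p167930). [folklore] -/
theorem hyp_nonempty_choiceDim_zero : ∀ p : ℕ, Nonempty (Summit.ResolutionOfSingularities.ResolutionOfSingularities.Theorems.HypersurfaceCentreChoiceDim p 0) :=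
  Summit.ResolutionOfSingularities.ResolutionOfSingularities.Theorems.hyp_nonempty_choiceDim_zero

/-- The one-piece choice (RESHAPE 9, first half) implies the ladder: a choice is a choice in every transversal dimension
(`HypersurfaceCentreChoiceDim.ofChoice`, LANDED p166405). [folklore] -/
theorem stub_hypersurfaceChoiceDim_of_hypersurfaceChoice
    (hC : ∀ p : ℕ, p.Prime → Nonempty (Summit.ResolutionOfSingularities.ResolutionOfSingularities.Theorems.HypersurfaceCentreChoice p)) :
    ∀ p : ℕ, p.Prime → ∀ e : ℕ, Nonempty (Summit.ResolutionOfSingularities.ResolutionOfSingularities.Theorems.HypersurfaceCentreChoiceDim p e) :=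
  fun p hp e => Summit.ResolutionOfSingularities.ResolutionOfSingularities.Theorems.HypersurfaceCentreChoiceDim.nonempty_of_nonempty_choice (hC p hp) e

/-- RESHAPE 8's strategy implies the ladder (strategy ⇒ choice ⇒ every rung). [folklore] -/
theorem stub_hypersurfaceChoiceDim_of_hypersurfaceStrategy
    (hS : ∀ p : ℕ, p.Prime → Nonempty (Summit.ResolutionOfSingularities.ResolutionOfSingularities.Theorems.HypersurfaceCentreStrategy p)) :
    ∀ p : ℕ, p.Prime → ∀ e : ℕ, Nonempty (Summit.ResolutionOfSingularities.ResolutionOfSingularities.Theorems.HypersurfaceCentreChoiceDim p e) :=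
  fun p hp e => Summit.ResolutionOfSingularities.ResolutionOfSingularities.Theorems.HypersurfaceCentreChoiceDim.nonempty_of_nonempty_strategy (hS p hp) e

/-- Item stmt-0571 `WeightedConstruction` implies the ladder (datum ⇒ hypersurface datum ⇒ strategy ⇒ choice ⇒ every rung).
[folklore] -/
theorem stub_hypersurfaceChoiceDim_of_weightedConstruction (hC : WeightedConstruction) :
    ∀ p : ℕ, p.Prime → ∀ e : ℕ, Nonempty (Summit.ResolutionOfSingularities.ResolutionOfSingularities.Theorems.HypersurfaceCentreChoiceDim p e) :=
  fun p hp e => Summit.ResolutionOfSingularities.ResolutionOfSingularities.Theorems.HypersurfaceCentreChoiceDim.nonempty_of_nonempty_datum (hC p hp) e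

/-! ### RESHAPE 10 (lead c9): tower-typed homogeneity `(H_T)` — the tower torus exposed -/

/-- PORT (RESHAPE 10) — **a grading by the one-element group `ℤ⁰` is trivial** (where the tower charts START) — LANDED with the
RESHAPE 10 objects file `Theorems/WeightedInvariantWeightedThesisHypersurfaceChoiceT.lean` (p168700). [folklore] -/
theorem hyp_mem_of_gradedRing_fin_zero : ∀ {R : Type} [CommRing R] (𝒢 : (Fin 0 → ℤ) → AddSubgroup R) [GradedRing 𝒢] (v : Fin 0 → ℤ) (x : R), x ∈ 𝒢 v :=
  fun 𝒢 _ v x => Summit.ResolutionOfSingularities.ResolutionOfSingularities.Theorems.hyp_mem_of_gradedRing_fin_zero 𝒢 v x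

/-- PORT (RESHAPE 10) — **the ambient chart `D(β t^{Dg})` of the rank-`j+1` atlas is a TOWER chart** (the tree's
`AtlasAmbient.exists_ambientChart` re-run with the grading exposed: `TowerChartStep (W a) j (𝒜.piece a) R' W' piece`; file
`Theorems/…HypersurfaceChoiceTChart.lean`). — LANDED (`Theorems/WeightedInvariantWeightedThesisHypersurfaceChoiceTChart.lean`, p169389). [cite: Wlodarczyk2022, §2.3.3] -/
theorem hyp_exists_ambientChart_towerTyped : ∀ {k : Type} [Field k] {Y X V : AlgebraicGeometry.Scheme.{0}} (f : Y ⟶ AlgebraicGeometry.Spec (.of k)) (i : X ⟶ Y) [AlgebraicGeometry.IsClosedImmersion i] (q : X ⟶ V) {j : ℕ} (𝒜 : Summit.ResolutionOfSingularities.ResolutionOfSingularities.Theorems.GradedAtlas j f i q) (R' : Literature.AlgebraicGeometry.Resolution.ReesFiltration Y) [AlgebraicGeometry.IsReduced X] [AlgebraicGeometry.IsLocallyNoetherian R'.cobordantBlowup] (a : 𝒜.ι), (∀ n : ℕ, @Ideal.IsHomogeneous (Fin j → ℤ) (AddSubgroup Γ(Y, 𝒜.W a)) Γ(Y, 𝒜.W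 a) _ _ _ (𝒜.piece a) _ _ (𝒜.gradedRing a) ((R'.ideal n).ideal (𝒜.W a))) → ∀ {Dg : ℕ}, 0 < Dg → ∀ {β : Γ(Y, 𝒜.W a)}, β ∈ (R'.ideal Dg).ideal (𝒜.W a) → β ∈ 𝒜.piece a 0 → ∃ 𝒞 : Summit.ResolutionOfSingularities.ResolutionOfSingularities.Theorems.AmbientChart j f i q 𝒜 R'.ideal R' Dg a β, (∀ x : Γ(Y, 𝒜.W a), R'.πPlus.appLE (𝒜.W a) 𝒞.W' 𝒞.le_preimage x ∈ (R'.strictTransformPlus i.ker).ideal 𝒞.W' → x * β ∈ i.ker.ideal (𝒜.W a)) ∧ Summit.ResolutionOfSingularities.ResolutionOfSingularities.Theorems.TowerChartStep (𝒜.W a) j (𝒜.piece a) R' 𝒞.W' 𝒞.piece := by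
  intro k _ Y X V f i _ q j 𝒜 R' _ _ a hhom Dg hDg β hβJ hβ0
  exact Summit.ResolutionOfSingularities.ResolutionOfSingularities.Theorems.DatumToEmbedded.AtlasAmbient.hyp_exists_ambientChart_towerTyped f i q 𝒜 R' a hhom hDg hβJ hβ0

/-- PORT (RESHAPE 10) — **the quotient step with the successor atlas certified to consist of tower charts** (the tree's
`quotientStep_of_isRegularWeightedCentre` / `gradedAtlas_succ_of_isRegularWeightedCentre` re-run on the tower-typed charts;
file `Theorems/…HypersurfaceChoiceTAtlas.lean`). — LANDED (`Theorems/WeightedInvariantWeightedThesisHypersurfaceChoiceTAtlas.lean`). [cite: Wlodarczyk2022, §2.3.3 and Thm 1.1.4 (5)] -/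
theorem hyp_quotientStep_towerTyped : ∀ {k : Type} [Field k] {Y X V : AlgebraicGeometry.Scheme.{0}} (f : Y ⟶ AlgebraicGeometry.Spec (.of k)) [AlgebraicGeometry.Smooth f] [AlgebraicGeometry.IsSeparated f] [AlgebraicGeometry.QuasiCompact f] (i : X ⟶ Y) [AlgebraicGeometry.IsClosedImmersion i] [AlgebraicGeometry.IsIntegral X] (q : X ⟶ V) [AlgebraicGeometry.IsIntegral V] (g : V ⟶ AlgebraicGeometry.Spec (.of k)) [AlgebraicGeometry.IsSeparated g] [AlgebraicGeometry.LocallyOfFiniteType g] [AlgebraicGeometry.QuasiCompact g], q ≫ g = i ≫ f → ∀ {j : ℕ} (𝒜 : Summit.ResolutionOfSingularities.ResolutionOfSingularities.Theorems.GradedAtlas j f i q) (R : Literature.AlgebraicGeometry.Resolution.ReesAlgebraData Y), R.IsRegularWeightedCentre → i (genericPoint X) ∉ R.support → (∀ (a : 𝒜.ι) (n : ℕ), @Ideal.IsHomogeneous (Fin j → ℤ) (AddSubgroup Γ(Y, 𝒜.W a)) Γ(Y, 𝒜.W a) _ _ _ (𝒜.piece a) _ _ (𝒜.gradedRing a) ((R.piece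 n).ideal (𝒜.W a))) → ∀ (R' : Literature.AlgebraicGeometry.Resolution.ReesFiltration Y), R'.ideal = R.piece → ∀ [AlgebraicGeometry.Smooth (R'.πPlus ≫ f)] [AlgebraicGeometry.IsSeparated (R'.πPlus ≫ f)] [AlgebraicGeometry.QuasiCompact (R'.πPlus ≫ f)] [AlgebraicGeometry.IsIntegral (R'.strictTransformPlus i.ker).subscheme] (σX : (R'.strictTransformPlus i.ker).subscheme ⟶ X), σX ≫ i = (R'.strictTransformPlus i.ker).subschemeι ≫ R'.πPlus → ∃ K : V.IdealSheafData, K ≠ ⊥ ∧ ∀ (V' : AlgebraicGeometry.Scheme.{0}) (ρ : V' ⟶ V), Literature.AlgebraicGeometry.Resolution.IsBlowup ρ K → ∀ [AlgebraicGeometry.IsIntegral V'], ∃ q' : (R'.strictTransformPlus i.ker).subscheme ⟶ V', q' ≫ ρ = σX ≫ q ∧ ∃ 𝒜' : Summit.ResolutionOfSingularities.ResolutionOfSingularities.Theorems.GradedAtlas (j + 1) (R'.πPlus ≫ f) (R'.strictTransformPlus i.ker).subschemeι q', ∀ b : 𝒜'.ι, ∃ a : 𝒜.ι, Summit.ResolutionOfSingularities.ResolutionOfSingularities.Theorems.TowerChartStep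 (𝒜.W a) j (𝒜.piece a) R' (𝒜'.W b) (𝒜'.piece b) := by
  intro k _ Y X V f _ _ _ i _ _ q _ g _ _ _ hq j 𝒜 R hc hξ hhom R' hR' _ _ _ _ σX hσX
  exact Summit.ResolutionOfSingularities.ResolutionOfSingularities.Theorems.DatumToEmbedded.hyp_quotientStep_towerTyped f i q g hq 𝒜 R hc hξ hhom R' hR' σX hσX


/-- RESHAPE 9's ladder implies RESHAPE 10's: `(H) ⇒ (H_T)` rung by rung (`HypersurfaceCentreChoiceTDim.ofChoiceDim`, LANDED
p168700: a tower chart has the constants in degree `0`). [folklore] -/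
theorem stub_hypersurfaceChoiceTDim_of_hypersurfaceChoiceDim
    (hC : ∀ p : ℕ, p.Prime → ∀ e : ℕ, Nonempty (Summit.ResolutionOfSingularities.ResolutionOfSingularities.Theorems.HypersurfaceCentreChoiceDim p e)) :
    ∀ p : ℕ, p.Prime → ∀ e : ℕ, Nonempty (Summit.ResolutionOfSingularities.ResolutionOfSingularities.Theorems.HypersurfaceCentreChoiceTDim p e) :=
  fun p hp e => Summit.ResolutionOfSingularities.ResolutionOfSingularities.Theorems.HypersurfaceCentreChoiceTDim.nonempty_of_nonempty_choiceDim (hC p hp e)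

/-- Item stmt-0571 `WeightedConstruction` implies the tower-typed ladder (datum ⇒ … ⇒ choice ⇒ rung ⇒ tower-typed rung).
[folklore] -/
theorem stub_hypersurfaceChoiceTDim_of_weightedConstruction (hC : WeightedConstruction) :
    ∀ p : ℕ, p.Prime → ∀ e : ℕ, Nonempty (Summit.ResolutionOfSingularities.ResolutionOfSingularities.Theorems.HypersurfaceCentreChoiceTDim p e) :=
  fun p hp e => Summit.ResolutionOfSingularities.ResolutionOfSingularities.Theorems.HypersurfaceCentreChoiceTDim.nonempty_of_nonempty_datum (hC p hp) e

/-- The bottom rung of the tower-typed ladder is inhabited (`e = 0`: RESHAPE 9's rung through `(H) ⇒ (H_T)`). [folklore] -/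
theorem hyp_nonempty_choiceTDim_zero (p : ℕ) :
    Nonempty (Summit.ResolutionOfSingularities.ResolutionOfSingularities.Theorems.HypersurfaceCentreChoiceTDim p 0) :=
  Summit.ResolutionOfSingularities.ResolutionOfSingularities.Theorems.HypersurfaceCentreChoiceTDim.nonempty_of_nonempty_choiceDim
    (hyp_nonempty_choiceDim_zero p)

/-! ### RESHAPE 11 (lead c9): TOWER-INDEXED choices — the torus in the STATE -/

/-- PORT (RESHAPE 11) — **every ideal is homogeneous for a grading one of whose pieces is the whole ring** (the charts of the EMPTY
tower carry the trivial `ℤ⁰`-grading) — LANDED with the RESHAPE 11 objects file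
`Theorems/WeightedInvariantWeightedThesisHypersurfaceTowerChoice.lean` (p169414). [folklore] -/
theorem hyp_isHomogeneous_of_forall_mem : ∀ {ι R : Type} [DecidableEq ι] [AddMonoid ι] [CommRing R] (𝒢 : ι → AddSubgroup R) [GradedRing 𝒢] (i₀ : ι), (∀ x : R, x ∈ 𝒢 i₀) → ∀ I : Ideal R, I.IsHomogeneous 𝒢 :=
  fun 𝒢 _ i₀ h I => Summit.ResolutionOfSingularities.ResolutionOfSingularities.Theorems.hyp_isHomogeneous_of_forall_mem 𝒢 i₀ h I

/-- PORT (RESHAPE 11) — **the composition through the tower-indexed ladder** (conclusion = the crux `WeightedThesis` UNFOLDED, so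
that this port is not read as a skeleton of the crux): tower-indexed choices in every transversal dimension
at every prime and prime-wise Bergh–Rydh give `WeightedThesis` (Włodarczyk's cobordant tower run ON TOWER DATA: well-founded induction on
"extend a run from dimension `e` by its prescribed step", the state `⟨P, τ⟩` carrying a torus-quotient presentation whose atlas consists of
charts of the tower; the presentation's `i.ker = P.X` is carried propositionally since no `subst` is possible under the tower; file
`Theorems/…HypersurfaceTowerChoiceTower.lean`). — LANDED (`Theorems/WeightedInvariantWeightedThesisHypersurfaceTowerChoiceTower.lean`). [cite: Wlodarczyk2022, Thm 1.1.6; BerghRydh2019, Thm 5] -/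
theorem perfectResolution_of_hypersurfaceTowerChoiceDim_of_forall_berghRydh_charP : (∀ p : ℕ, p.Prime → ∀ e : ℕ, Nonempty (Summit.ResolutionOfSingularities.ResolutionOfSingularities.Theorems.HypersurfaceTowerChoiceDim p e)) → (∀ p : ℕ, p.Prime → ∀ (k : Type) [Field k] [CharP k p] [PerfectField k] (V : AlgebraicGeometry.Scheme.{0}) (g : V ⟶ AlgebraicGeometry.Spec (.of k)) [AlgebraicGeometry.IsIntegral V] [AlgebraicGeometry.IsSeparated g] [AlgebraicGeometry.LocallyOfFiniteType g] [AlgebraicGeometry.QuasiCompact g], (∀ v : V, ∃ (A : Type) (_ : AddCommGroup A) (_ : Finite A) (_ : DecidableEq A) (S : Type) (_ : CommRing S) (_ : Algebra k S) (𝒮 : A → Submodule k S) (_ : GradedAlgebra 𝒮), Algebra.FiniteType k S ∧ Algebra.Smooth k S ∧ ∃ φ : AlgebraicGeometry.Spec (.of (𝒮 0)) ⟶ V, AlgebraicGeometry.Etale φ ∧ v ∈ Set.range φ ∧ φ ≫ g = AlgebraicGeometry.Spec.map (CommRingCat.ofHom (algebraMap k (𝒮 0)))) → Literature.AlgebraicGeometry.Resolution.Scheme.HasResolution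 V) → ∀ p : ℕ, p.Prime → ∀ (k : Type) [Field k] [CharP k p] [PerfectField k] (X : AlgebraicGeometry.Scheme.{0}) (f : X ⟶ AlgebraicGeometry.Spec (.of k)), AlgebraicGeometry.IsSeparated f → AlgebraicGeometry.LocallyOfFiniteType f → AlgebraicGeometry.QuasiCompact f → AlgebraicGeometry.IsReduced X → Literature.AlgebraicGeometry.Resolution.Scheme.HasResolution X :=
  Summit.ResolutionOfSingularities.ResolutionOfSingularities.Theorems.perfectResolution_of_hypersurfaceTowerChoiceDim_of_forall_berghRydh_charP


/-- RESHAPE 10's ladder implies RESHAPE 11's: a pair-indexed tower-typed choice is a tower-indexed one (`HypersurfaceTowerChoiceDim.ofChoiceTDim`,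
LANDED p169414: read the centre off the end pair; a run is a `Step`-chain; a chart of the tower is a tower chart of the end pair). [folklore] -/
theorem stub_hypersurfaceTowerChoiceDim_of_hypersurfaceChoiceTDim
    (hC : ∀ p : ℕ, p.Prime → ∀ e : ℕ, Nonempty (Summit.ResolutionOfSingularities.ResolutionOfSingularities.Theorems.HypersurfaceCentreChoiceTDim p e)) :
    ∀ p : ℕ, p.Prime → ∀ e : ℕ, Nonempty (Summit.ResolutionOfSingularities.ResolutionOfSingularities.Theorems.HypersurfaceTowerChoiceDim p e) :=
  fun p hp e => (hC p hp e).map Summit.ResolutionOfSingularities.ResolutionOfSingularities.Theorems.HypersurfaceTowerChoiceDim.ofChoiceTDim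

/-- Item stmt-0571 `WeightedConstruction` implies the tower-indexed ladder (datum ⇒ … ⇒ `(H_T)`-rung ⇒ tower-indexed rung). [folklore] -/
theorem stub_hypersurfaceTowerChoiceDim_of_weightedConstruction (hC : WeightedConstruction) :
    ∀ p : ℕ, p.Prime → ∀ e : ℕ, Nonempty (Summit.ResolutionOfSingularities.ResolutionOfSingularities.Theorems.HypersurfaceTowerChoiceDim p e) :=
  stub_hypersurfaceTowerChoiceDim_of_hypersurfaceChoiceTDim (stub_hypersurfaceChoiceTDim_of_weightedConstruction hC)

/-- The bottom rung of the tower-indexed ladder is inhabited (`e = 0`, through the implications from RESHAPE 9's rung). [folklore] -/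
theorem hyp_nonempty_towerChoiceDim_zero (p : ℕ) :
    Nonempty (Summit.ResolutionOfSingularities.ResolutionOfSingularities.Theorems.HypersurfaceTowerChoiceDim p 0) :=
  (hyp_nonempty_choiceTDim_zero p).map Summit.ResolutionOfSingularities.ResolutionOfSingularities.Theorems.HypersurfaceTowerChoiceDim.ofChoiceTDim

/-! ### RESHAPE 8 port lemmas (LANDED) -/

/-- PORT (RESHAPE 8) — **a singular hypersurface pair has a point of non-minimal invariant**: axiom `(ii)` of a
hypersurface datum contraposed (the guard under which `(iii)`/`(iv)` speak) — LANDED with the RESHAPE 8 objects file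
`Theorems/WeightedInvariantWeightedThesisHypersurfaceStrategy.lean`. [folklore] -/
theorem hyp_exists_not_isBot_inv_of_not_isRegular : ∀ {p : ℕ} (D : Summit.ResolutionOfSingularities.ResolutionOfSingularities.Theorems.HypersurfaceResolutionDatum p) {k : Type} [Field k] [CharP k p] [PerfectField k] {Y : AlgebraicGeometry.Scheme.{0}} (f : Y ⟶ AlgebraicGeometry.Spec (.of k)) [AlgebraicGeometry.Smooth f] [AlgebraicGeometry.IsSeparated f] [AlgebraicGeometry.QuasiCompact f] (X : Y.IdealSheafData), Literature.AlgebraicGeometry.Resolution.IsLocallyPrincipal X → AlgebraicGeometry.IsIntegral X.subscheme → ¬ Literature.AlgebraicGeometry.Resolution.Scheme.IsRegular X.subscheme → ∃ y : Y, ¬ IsBot (D.inv f X y) :=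
  fun D _ _ _ _ _ f _ _ _ X hX hXi hsing =>
    Summit.ResolutionOfSingularities.ResolutionOfSingularities.Theorems.hyp_exists_not_isBot_inv_of_not_isRegular D f X hX hXi hsing

/-- PORT (RESHAPE 8) — **every hypersurface datum is a strategy** — LANDED
(`Theorems/WeightedInvariantWeightedThesisHypersurfaceStrategyTower.lean`). [folklore] -/
theorem hyp_nonempty_strategy_of_hypersurfaceDatum : ∀ {p : ℕ}, Summit.ResolutionOfSingularities.ResolutionOfSingularities.Theorems.HypersurfaceResolutionDatum p → Nonempty (Summit.ResolutionOfSingularities.ResolutionOfSingularities.Theorems.HypersurfaceCentreStrategy p) :=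
  fun D => Summit.ResolutionOfSingularities.ResolutionOfSingularities.Theorems.HypersurfaceStrategyTower.hyp_nonempty_strategy_of_hypersurfaceDatum D

/-- PORT (RESHAPE 8, door (γ)) — **a function with finitely many values on a non-empty type attains its maximum** —
LANDED (`Theorems/WeightedInvariantWeightedThesisHypersurfaceRatedRule.lean`). [folklore] -/
theorem hyp_exists_isMax_of_finite_range : ∀ {Y Γ : Type} [LinearOrder Γ] [Nonempty Y] (v : Y → Γ), (Set.range v).Finite → ∃ y : Y, ∀ y' : Y, v y' ≤ v y :=
  fun v hv => Summit.ResolutionOfSingularities.ResolutionOfSingularities.Theorems.hyp_exists_isMax_of_finite_range v hv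

/-- PORT (RESHAPE 8, door (γ)) — **every hypersurface RATED rule is a strategy** (chartwise drop ⇒ global drop of `max inv`;
values met along the towers of one pair well-ordered ⇒ every pair accessible) — LANDED
(`Theorems/WeightedInvariantWeightedThesisHypersurfaceRatedRuleStrategy.lean`). [folklore] -/
theorem hyp_nonempty_strategy_of_ratedRule : ∀ {p : ℕ}, Summit.ResolutionOfSingularities.ResolutionOfSingularities.Theorems.HypersurfaceRatedRule p → Nonempty (Summit.ResolutionOfSingularities.ResolutionOfSingularities.Theorems.HypersurfaceCentreStrategy p) :=
  fun R => Summit.ResolutionOfSingularities.ResolutionOfSingularities.Theorems.hyp_nonempty_strategy_of_ratedRule R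


/-- RESHAPE 7's stub H (`∀ p, Nonempty (HypersurfaceResolutionDatum p)`) implies stub S: every hypersurface datum is a
strategy (forget `Γ` and `inv`; termination by the drop of `max inv` —
`HypersurfaceStrategyTower.hyp_nonempty_strategy_of_hypersurfaceDatum`, LANDED). [folklore] -/
theorem stub_hypersurfaceStrategy_of_hypersurfaceConstruction
    (hH : ∀ p : ℕ, p.Prime → Nonempty (Summit.ResolutionOfSingularities.ResolutionOfSingularities.Theorems.HypersurfaceResolutionDatum p)) :
    ∀ p : ℕ, p.Prime → Nonempty (Summit.ResolutionOfSingularities.ResolutionOfSingularities.Theorems.HypersurfaceCentreStrategy p) :=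
  fun p hp => Summit.ResolutionOfSingularities.ResolutionOfSingularities.Theorems.HypersurfaceStrategyTower.hyp_nonempty_strategy_of_hypersurfaceDatum
    (Classical.choice (hH p hp))

/-- A hypersurface RATED rule at every prime (door (γ): invariant into a linear order, well-ordered only along the towers of
one pair) implies stub S. [folklore] -/
theorem stub_hypersurfaceStrategy_of_ratedRule
    (hR : ∀ p : ℕ, p.Prime → Nonempty (Summit.ResolutionOfSingularities.ResolutionOfSingularities.Theorems.HypersurfaceRatedRule p)) :
    ∀ p : ℕ, p.Prime → Nonempty (Summit.ResolutionOfSingularities.ResolutionOfSingularities.Theorems.HypersurfaceCentreStrategy p) :=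
  fun p hp => hyp_nonempty_strategy_of_ratedRule (Classical.choice (hR p hp))

/-- RESHAPE 7's stub H implies a rated rule at every prime (`HypersurfaceRatedRule.ofDatum`: finitely many values by `(usc)`,
the tower-wise well-order from the global one). [folklore] -/
theorem ratedRule_of_hypersurfaceConstruction
    (hH : ∀ p : ℕ, p.Prime → Nonempty (Summit.ResolutionOfSingularities.ResolutionOfSingularities.Theorems.HypersurfaceResolutionDatum p)) :
    ∀ p : ℕ, p.Prime → Nonempty (Summit.ResolutionOfSingularities.ResolutionOfSingularities.Theorems.HypersurfaceRatedRule p) :=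
  fun p hp => Summit.ResolutionOfSingularities.ResolutionOfSingularities.Theorems.HypersurfaceRatedRule.nonempty_of_nonempty_hypersurfaceDatum (hH p hp)

/-- Item stmt-0571 `WeightedConstruction` implies stub S (datum ⇒ hypersurface datum ⇒ strategy):
RESHAPE 8 weakens the line's first input a second time. [folklore] -/
theorem stub_hypersurfaceStrategy_of_weightedConstruction (hC : WeightedConstruction) :
    ∀ p : ℕ, p.Prime → Nonempty (Summit.ResolutionOfSingularities.ResolutionOfSingularities.Theorems.HypersurfaceCentreStrategy p) :=
  fun p hp => Summit.ResolutionOfSingularities.ResolutionOfSingularities.Theorems.HypersurfaceStrategyTower.nonempty_strategy_of_datum (hC p hp)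

/-- RESHAPE 7's implication kept: item stmt-0571 `WeightedConstruction` implies the hypersurface construction
(forget the axioms off hypersurface pairs, `HypersurfaceResolutionDatum.ofDatum`). [folklore] -/
theorem stub_hypersurfaceConstruction_of_weightedConstruction (hC : WeightedConstruction) :
    ∀ p : ℕ, p.Prime → Nonempty (Summit.ResolutionOfSingularities.ResolutionOfSingularities.Theorems.HypersurfaceResolutionDatum p) :=
  fun p hp => Summit.ResolutionOfSingularities.ResolutionOfSingularities.Theorems.HypersurfaceResolutionDatum.nonempty_of_nonempty_datum (hC p hp)

/-- STUB BR-p (RESHAPE 6) = the characteristic-`p` instances of the NAMED PUBLISHED FACT Bergh–Rydh 2019,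
Thm 5, diagonalizable étale-local case: for every prime `p` and every perfect field `k` of characteristic
`p`, an integral separated `k`-scheme of finite type covered by the images of étale `k`-morphisms from
degree-`0` parts `Spec S₀` of finite-abelian-group-graded smooth finitely generated `k`-algebras `S`
(quotients `U/D(A)` of smooth affines by finite diagonalizable group schemes) admits a resolution of
singularities. Implied verbatim by the recorded fact `BerghRydh2019_diagonalizableQuotientResolution` (all
perfect fields; `stub_berghRydh2019_charP_of_berghRydh2019` below) and, granted stub 1, EQUIVALENT to the
crux (`Theorems/WeightedInvariantWeightedThesisBerghRydhCharP.lean`,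
`weightedThesis_iff_forall_berghRydh_charP`). Discharging it is a formalisation of tame destackification
(Bergh–Rydh Thm 2 + Satriano) or of toroidal resolution of simplicial toric singularities glued along
étale charts, in characteristic `p` — crux-sized. [cite: BerghRydh2019, Thm 5 (arXiv:1905.00872, p. 4)] -/
theorem stub_berghRydh2019_charP :
    ∀ p : ℕ, p.Prime → ∀ (k : Type) [Field k] [CharP k p] [PerfectField k] (V : AlgebraicGeometry.Scheme.{0}) (g : V ⟶ AlgebraicGeometry.Spec (.of k)) [AlgebraicGeometry.IsIntegral V] [AlgebraicGeometry.IsSeparated g] [AlgebraicGeometry.LocallyOfFiniteType g] [AlgebraicGeometry.QuasiCompact g], (∀ v : V, ∃ (A : Type) (_ : AddCommGroup A) (_ : Finite A) (_ : DecidableEq A) (S : Type) (_ : CommRing S) (_ : Algebra k S) (𝒮 : A → Submodule k S) (_ : GradedAlgebra 𝒮), Algebra.FiniteType k S ∧ Algebra.Smooth k S ∧ ∃ φ : AlgebraicGeometry.Spec (.of (𝒮 0)) ⟶ V, AlgebraicGeometry.Etale φ ∧ v ∈ Set.range φ ∧ φ ≫ g = AlgebraicGeometry.Spec.map (CommRingCat.ofHom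 (algebraMap k (𝒮 0)))) → Literature.AlgebraicGeometry.Resolution.Scheme.HasResolution V := by
  sorry

/-- The recorded named fact (all perfect fields) implies stub BR-p (its characteristic-`p` instances):
the RESHAPE 5 stub `stub_berghRydh2019 : BerghRydh2019_diagonalizableQuotientResolution` was stronger than
needed. [cite: BerghRydh2019, Thm 5] -/
theorem stub_berghRydh2019_charP_of_berghRydh2019
    (hBR : Literature.AlgebraicGeometry.Resolution.BerghRydh2019_diagonalizableQuotientResolution) :
    ∀ p : ℕ, p.Prime → ∀ (k : Type) [Field k] [CharP k p] [PerfectField k] (V : AlgebraicGeometry.Scheme.{0}) (g : V ⟶ AlgebraicGeometry.Spec (.of k)) [AlgebraicGeometry.IsIntegral V] [AlgebraicGeometry.IsSeparated g] [AlgebraicGeometry.LocallyOfFiniteType g] [AlgebraicGeometry.QuasiCompact g], (∀ v : V, ∃ (A : Type) (_ : AddCommGroup A) (_ : Finite A) (_ : DecidableEq A) (S : Type) (_ : CommRing S) (_ : Algebra k S) (𝒮 : A → Submodule k S) (_ : GradedAlgebra 𝒮), Algebra.FiniteType k S ∧ Algebra.Smooth k S ∧ ∃ φ : AlgebraicGeometry.Spec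 (.of (𝒮 0)) ⟶ V, AlgebraicGeometry.Etale φ ∧ v ∈ Set.range φ ∧ φ ≫ g = AlgebraicGeometry.Spec.map (CommRingCat.ofHom (algebraMap k (𝒮 0)))) → Literature.AlgebraicGeometry.Resolution.Scheme.HasResolution V :=
  fun _ _ k _ _ _ V g _ _ _ _ hV => hBR k V g hV

/-- Item stmt-0572 `DatumToEmbedded` (all codimensions), from stub BR-p — LANDED field-wise
(`Theorems/WeightedInvariantWeightedThesisBerghRydhCharP.lean`, p151492,
`datumToEmbedded_of_forall_berghRydh_charP`; RESHAPE 5 used `datumToEmbedded_of_berghRydh2019`, p129265).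
[cite: Wlodarczyk2022, Thm 1.1.6; BerghRydh2019, Thm 5] -/
theorem datumToEmbedded : DatumToEmbedded :=
  Summit.ResolutionOfSingularities.ResolutionOfSingularities.Theorems.WeightedThesis.BerghRydhCharP.datumToEmbedded_of_forall_berghRydh_charP
    stub_berghRydh2019_charP

/-- STUB 2' (RESHAPE 2; a THEOREM since RESHAPE 5): a weighted resolution datum `D` in characteristic
`p` resolves every integral closed `i : X ⟶ Y` WITH LOCALLY PRINCIPAL IDEAL SHEAF (a hypersurface of
`Y`), `Y` smooth separated quasi-compact over a perfect field of characteristic `p`, whenever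
`D.inv f i.ker` is NOT everywhere minimal. Content: Włodarczyk's cobordant tower followed by the torus
quotient of the terminal stage and tame destackification — now the landed `DatumToEmbedded` (all
codimensions, modulo stub BR) specialised to hypersurfaces; the minimal case is LANDED separately
(`Theorems/WeightedInvariantWeightedThesisZeroStep.lean`). [cite: Wlodarczyk2022, Thm 1.1.6;
BerghRydh2019, Thm 5] -/
theorem stub_datumToHypersurfaceNonminimal :
    ∀ (p : ℕ), p.Prime → ∀ (D : Literature.AlgebraicGeometry.Resolution.WeightedResolutionDatum p) (k : Type) [Field k] [CharP k p] [PerfectField k] (Y X : AlgebraicGeometry.Scheme.{0}) (f : Y ⟶ AlgebraicGeometry.Spec (.of k)) (i : X ⟶ Y), AlgebraicGeometry.Smooth f → AlgebraicGeometry.IsSeparated f → AlgebraicGeometry.QuasiCompact f → AlgebraicGeometry.IsClosedImmersion i → AlgebraicGeometry.IsIntegral X → (∀ y : Y, ∃ U : Y.affineOpens, y ∈ (U : Y.Opens) ∧ (i.ker.ideal U).IsPrincipal) → (∃ y : Y, ¬ IsBot (D.inv f i.ker y)) → Literature.AlgebraicGeometry.Resolution.Scheme.HasResolution X :=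
  fun p hp D k _ _ _ Y X f i hf hsep hqc hi hint _ _ => datumToEmbedded p hp ⟨D⟩ k Y X f i hf hsep hqc hi hint

/-- Zero-step case (LANDED as `Theorems/WeightedInvariantWeightedThesisZeroStep.lean`, p87961; inlined so
that the workfile elaborates independently of the build state): if `inv` is everywhere minimal on
`(Y, i.ker)` then `X ≅ i.image` is regular by axiom `(ii)`, hence its own resolution. [folklore] -/
theorem hasResolution_of_forall_isBot {p : ℕ} (D : WeightedResolutionDatum p) {k : Type} [Field k]
    [CharP k p] [PerfectField k] {Y X : Scheme.{0}} (f : Y ⟶ Spec (.of k)) [Smooth f]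
    [IsSeparated f] [QuasiCompact f] (i : X ⟶ Y) [IsClosedImmersion i]
    (h : ∀ y : Y, IsBot (D.inv f i.ker y)) : Scheme.HasResolution X :=
  have hreg : Scheme.IsRegular i.ker.subscheme := fun x =>
    (D.isBot_inv_iff f i.ker (i.ker.subschemeι x)).mp (h _) x rfl
  (Scheme.IsRegular.hasResolution hreg).of_iso (inv i.toImage)

/-- A datum resolves every integral HYPERSURFACE of a smooth separated quasi-compact `Y` over a
perfect field of characteristic `p`: stub 2' off the minimal case, the zero step on it. [folklore] -/
theorem hasResolution_hypersurface_of_datum {p : ℕ} (hp : p.Prime) (D : WeightedResolutionDatum p)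
    {k : Type} [Field k] [CharP k p] [PerfectField k] {Y X : Scheme.{0}} (f : Y ⟶ Spec (.of k))
    [Smooth f] [IsSeparated f] [QuasiCompact f] (i : X ⟶ Y) [IsClosedImmersion i] [IsIntegral X]
    (hprinc : ∀ y : Y, ∃ U : Y.affineOpens, y ∈ (U : Y.Opens) ∧ (i.ker.ideal U).IsPrincipal) :
    Scheme.HasResolution X := by
  by_cases h : ∀ y : Y, IsBot (D.inv f i.ker y)
  · exact hasResolution_of_forall_isBot D f i h
  · push Not at h
    exact stub_datumToHypersurfaceNonminimal p hp D k Y X f i ‹_› ‹_› ‹_› ‹_› ‹_› hprinc h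

/-- Item stmt-0572 `DatumToEmbedded` (all codimensions) implies stub 2' (codimension one).
[folklore] -/
theorem stub_datumToHypersurfaceNonminimal_of_datumToEmbedded (hE : DatumToEmbedded) :
    ∀ (p : ℕ), p.Prime → ∀ (D : Literature.AlgebraicGeometry.Resolution.WeightedResolutionDatum p) (k : Type) [Field k] [CharP k p] [PerfectField k] (Y X : AlgebraicGeometry.Scheme.{0}) (f : Y ⟶ AlgebraicGeometry.Spec (.of k)) (i : X ⟶ Y), AlgebraicGeometry.Smooth f → AlgebraicGeometry.IsSeparated f → AlgebraicGeometry.QuasiCompact f → AlgebraicGeometry.IsClosedImmersion i → AlgebraicGeometry.IsIntegral X → (∀ y : Y, ∃ U : Y.affineOpens, y ∈ (U : Y.Opens) ∧ (i.ker.ideal U).IsPrincipal) → (∃ y : Y, ¬ IsBot (D.inv f i.ker y)) → Literature.AlgebraicGeometry.Resolution.Scheme.HasResolution X :=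
  fun p hp D k _ _ _ Y X f i hf hsep hqc hi hint _ _ => hE p hp ⟨D⟩ k Y X f i hf hsep hqc hi hint

/-- STUB 3 (tree glue, every field) — LANDED (cycle 1, p86611). [cite: CossartPiltant2019, Prop. 4.6 (proof, Steps 1–3)] -/
theorem stub_projectiveIntegralSuffices :
    ∀ (k : Type) [Field k],
      (∀ (n : ℕ) (X : Scheme.{0})
          (ι : X ⟶ (Literature.AlgebraicGeometry.Motives.projectiveSpace n k).left),
          IsClosedImmersion ι → IsIntegral X → Scheme.HasResolution X) →
      ∀ (X : Scheme.{0}) (f : X ⟶ Spec (.of k)), IsSeparated f → LocallyOfFiniteType f →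
        QuasiCompact f → IsReduced X → Scheme.HasResolution X :=
  Summit.ResolutionOfSingularities.ResolutionOfSingularities.Theorems.WeightedThesis.ProjectiveIntegralSuffices.stub_projectiveIntegralSuffices

/-- STUB 4 (RESHAPE 2) — LANDED (p98340): a finite birational morphism of integral schemes transports
resolutions down. [folklore; cite: StacksProject, Tag 035Q; DeJong1996, 4.20–4.21] -/
theorem stub_finiteBirationalTransfer :
    ∀ (X H : AlgebraicGeometry.Scheme.{0}) [AlgebraicGeometry.IsIntegral X] [AlgebraicGeometry.IsIntegral H] (φ : X ⟶ H), AlgebraicGeometry.IsFinite φ → Literature.AlgebraicGeometry.Resolution.IsBirational φ → Literature.AlgebraicGeometry.Resolution.Scheme.HasResolution H → Literature.AlgebraicGeometry.Resolution.Scheme.HasResolution X :=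
  Summit.ResolutionOfSingularities.ResolutionOfSingularities.Theorems.WeightedThesis.FiniteBirationalTransfer.stub_finiteBirationalTransfer

/-- STUB 5a (RESHAPE 3) — LANDED (p140615, `Theorems/WeightedInvariantWeightedThesisHypersurfaceModelInfinite.lean`):
**hypersurface models over INFINITE perfect fields** (generic linear projection).
[cite: Kollar2007, Prop. 2.48 (proof); Hartshorne1977, I Prop. 4.9] -/
theorem stub_hypersurfaceModel_infinite :
    ∀ (k : Type) [Field k] [PerfectField k] [Infinite k] (n : ℕ) (X : AlgebraicGeometry.Scheme.{0}) (ι : X ⟶ (Literature.AlgebraicGeometry.Motives.projectiveSpace n k).left), AlgebraicGeometry.IsClosedImmersion ι → AlgebraicGeometry.IsIntegral X → ∃ (Y H : AlgebraicGeometry.Scheme.{0}) (g : Y ⟶ AlgebraicGeometry.Spec (.of k)) (j : H ⟶ Y) (φ : X ⟶ H), AlgebraicGeometry.Smooth g ∧ AlgebraicGeometry.IsSeparated g ∧ AlgebraicGeometry.QuasiCompact g ∧ AlgebraicGeometry.IsClosedImmersion j ∧ AlgebraicGeometry.IsIntegral H ∧ (∀ y : Y, ∃ U : Y.affineOpens,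 y ∈ (U : Y.Opens) ∧ (j.ker.ideal U).IsPrincipal) ∧ AlgebraicGeometry.IsFinite φ ∧ Literature.AlgebraicGeometry.Resolution.IsBirational φ :=
  Summit.ResolutionOfSingularities.ResolutionOfSingularities.Theorems.WeightedThesis.HypersurfaceModel.stub_hypersurfaceModel_infinite

/-! ### RESHAPE 4: the finite-field branch -/

/-- STUB A-of-K (RESHAPE 4) — LANDED (wave 2, p142078, `Theorems/WeightedInvariantWeightedThesisSeparableProjectionOfKedlaya.lean`): **finite separable projections, from Kedlaya's theorem.** An integral closed subscheme `X` of `ℙⁿ_k`,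
`k` perfect of characteristic `p`, admits a finite surjective `k`-morphism `ψ : X → ℙ^d_k`,
`d = dim X`, along which `K(X)` is a finite SEPARABLE extension of `K(ℙ^d)`. From Kedlaya's theorem
(the named fact `Kedlaya2004_finite_etale_off_hyperplane`, taken as HYPOTHESIS: `ψ` may even be taken étale over `𝔸^d`, and étale at the generic point means
separable function field extension) by the glue `separableProjection_of_kedlaya`; classically also
by separable projective Noether normalisation with forms of high degree.
[cite: Kedlaya2004, Thm 1; Eisenbud1995, Cor. 16.18] -/
theorem stub_separableProjection_of_kedlaya :
    Literature.AlgebraicGeometry.Resolution.Kedlaya2004_finite_etale_off_hyperplane.{0} →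
    ∀ (p : ℕ), p.Prime → ∀ (k : Type) [Field k] [CharP k p] [PerfectField k] (n : ℕ)
      (X : AlgebraicGeometry.Scheme.{0}) [AlgebraicGeometry.IsIntegral X]
      (ι : X ⟶ (Literature.AlgebraicGeometry.Motives.projectiveSpace n k).left)
      [AlgebraicGeometry.IsClosedImmersion ι],
      ∃ (d : ℕ) (ψ : X ⟶ Literature.AlgebraicGeometry.Motives.ProjSpace.P d k)
        (_ : AlgebraicGeometry.IsFinite ψ) (_ : AlgebraicGeometry.Surjective ψ),
        ψ ≫ Literature.AlgebraicGeometry.Motives.Segre.toSpec (Fin (d + 1)) k =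
            ι ≫ (Literature.AlgebraicGeometry.Motives.projectiveSpace n k).hom ∧
        topologicalKrullDim X = d ∧
        ∀ [Algebra (Literature.AlgebraicGeometry.Motives.ProjSpace.P d k).functionField
            X.functionField],
          algebraMap (Literature.AlgebraicGeometry.Motives.ProjSpace.P d k).functionField
              X.functionField = Literature.AlgebraicGeometry.Motives.RatFn.functionFieldMap ψ →
          Algebra.IsSeparable (Literature.AlgebraicGeometry.Motives.ProjSpace.P d k).functionField
              X.functionField ∧
            Module.Finite (Literature.AlgebraicGeometry.Motives.ProjSpace.P d k).functionField
              X.functionField :=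
  Summit.ResolutionOfSingularities.ResolutionOfSingularities.Theorems.WeightedThesis.HypersurfaceModel.stub_separableProjection_of_kedlaya

/-- STUB A (RESHAPE 4), unconditional form — LANDED (wave 2, worker A2, `Theorems/WeightedInvariantWeightedThesisSeparableProjection*.lean`): separable projective Noether normalisation by forms of high degree prime to `p` with independent differentials: **finite separable projections**
`ψ : X → ℙ^d_k`, `d = dim X`, for integral closed `X ⊆ ℙⁿ_k` over a perfect field of characteristic
`p`. [cite: Kedlaya2004, Thm 1; Eisenbud1995, Cor. 16.18] -/
theorem stub_separableProjection :
    ∀ (p : ℕ), p.Prime → ∀ (k : Type) [Field k] [CharP k p] [PerfectField k] (n : ℕ)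
      (X : AlgebraicGeometry.Scheme.{0}) [AlgebraicGeometry.IsIntegral X]
      (ι : X ⟶ (Literature.AlgebraicGeometry.Motives.projectiveSpace n k).left)
      [AlgebraicGeometry.IsClosedImmersion ι],
      ∃ (d : ℕ) (ψ : X ⟶ Literature.AlgebraicGeometry.Motives.ProjSpace.P d k)
        (_ : AlgebraicGeometry.IsFinite ψ) (_ : AlgebraicGeometry.Surjective ψ),
        ψ ≫ Literature.AlgebraicGeometry.Motives.Segre.toSpec (Fin (d + 1)) k =
            ι ≫ (Literature.AlgebraicGeometry.Motives.projectiveSpace n k).hom ∧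
        topologicalKrullDim X = d ∧
        ∀ [Algebra (Literature.AlgebraicGeometry.Motives.ProjSpace.P d k).functionField
            X.functionField],
          algebraMap (Literature.AlgebraicGeometry.Motives.ProjSpace.P d k).functionField
              X.functionField = Literature.AlgebraicGeometry.Motives.RatFn.functionFieldMap ψ →
          Algebra.IsSeparable (Literature.AlgebraicGeometry.Motives.ProjSpace.P d k).functionField
              X.functionField ∧
            Module.Finite (Literature.AlgebraicGeometry.Motives.ProjSpace.P d k).functionField
              X.functionField :=
  Summit.ResolutionOfSingularities.ResolutionOfSingularities.Theorems.WeightedThesis.HypersurfaceModel.stub_separableProjection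

/-- STUB B (RESHAPE 4) — LANDED (wave 2, p141770, `Theorems/WeightedInvariantWeightedThesisGraphClosure.lean`): **the closure of the graph of a transcendental rational function.** For `X`
integral and locally Noetherian over a field `k` and `w ∈ K(X)` transcendental over `k`, the
scheme-theoretic image `X'` of the graph `U → X ×_k ℙ¹` of `w` on an affine open `U` where `w` is
regular is integral; `π : X' → X` is proper, dominant and BIRATIONAL (an isomorphism over `U`:
Stacks 01RH, tree `Morphisms/IsoOverOpen.GraphClosure.isIso_morphismRestrict`), `(π, ψ) : X' → X ×_k ℙ¹`
is a closed immersion, `π^♯ : K(X) ≅ K(X')`, and the second projection `ψ : X' → ℙ¹` is a dominant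
`k`-morphism with `ψ^♯ t = π^♯ w` for the coordinate `t = x₁/x₀` (tree `Motives/CyclesGraphClosure`,
`Motives/ProjectiveLineInvolution`). [folklore; cite: Fulton1998, Prop. 1.4 (a) (proof); Hartshorne1977, II Ex. 4.2] -/
theorem stub_graphClosure :
    ∀ (k : Type) [Field k] (X : AlgebraicGeometry.Scheme.{0}) [AlgebraicGeometry.IsIntegral X]
      [AlgebraicGeometry.IsLocallyNoetherian X] (fX : X ⟶ AlgebraicGeometry.Spec (.of k))
      (w : X.functionField),
      (letI := ((X.presheaf.germ ⊤ (genericPoint X) trivial).hom.comp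
          (fX.appTop.hom.comp (AlgebraicGeometry.Scheme.ΓSpecIso (.of k)).inv.hom)).toAlgebra;
        Transcendental k w) →
      ∃ (X' : AlgebraicGeometry.Scheme.{0}) (_ : AlgebraicGeometry.IsIntegral X') (π : X' ⟶ X)
        (_ : AlgebraicGeometry.IsProper π) (_ : AlgebraicGeometry.IsDominant π)
        (ψ : X' ⟶ Literature.AlgebraicGeometry.Motives.ProjSpace.P 1 k)
        (_ : AlgebraicGeometry.IsDominant ψ)
        (hc : π ≫ fX = ψ ≫ Literature.AlgebraicGeometry.Motives.Segre.toSpec (Fin (1 + 1)) k),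
        Literature.AlgebraicGeometry.Resolution.IsBirational π ∧
        AlgebraicGeometry.IsClosedImmersion (CategoryTheory.Limits.pullback.lift π ψ hc) ∧
        Function.Bijective (Literature.AlgebraicGeometry.Motives.RatFn.functionFieldMap π) ∧
        Literature.AlgebraicGeometry.Motives.RatFn.functionFieldMap ψ
            (Literature.AlgebraicGeometry.Motives.ProjLine.t k) =
          Literature.AlgebraicGeometry.Motives.RatFn.functionFieldMap π w :=
  Summit.ResolutionOfSingularities.ResolutionOfSingularities.Theorems.WeightedThesis.HypersurfaceModel.stub_graphClosure

/-- STUB C (RESHAPE 4) — LANDED (wave 2, p141747, `Theorems/WeightedInvariantWeightedThesisImageLocallyPrincipal.lean`): **the image of a finite morphism from an integral `d`-fold to a smooth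
`(d+1)`-fold has locally principal ideal.** For `Φ : X' → Y` finite, `X'` integral of dimension
`d`, `Y` integral, smooth over a field `k`, of dimension `d + 1`: every point of `Y` has an affine
neighbourhood on which the kernel ideal sheaf of `Φ` is principal. Indeed the closed image
`cl{Φ(η)}` has dimension `d` (finite morphisms preserve dimension), so `ζ = Φ(η)` has codimension
one (`height + coheight = dim`, tree `Motives/CyclesDivisorDimensionProofs`); `Y` is regular
(smooth over a field), its local rings are factorial (Auslander–Buchsbaum, tree
`RegularLocalRingsUFD`), so the prime divisor `cl{ζ}` is an effective Cartier divisor (tree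
`PrimeDivisorIdeals.isEffectiveCartier_primeDivisorIdeal_of_isRegular`); and `ker Φ` is the
vanishing ideal sheaf of `cl{ζ}` (`X'` reduced, `Φ` quasi-compact).
[folklore; cite: GortzWedhorn2020, Thm. 11.40 (2); Hartshorne1977, II Prop. 6.11] -/
theorem stub_imageLocallyPrincipal :
    ∀ (k : Type) [Field k] (X' Y : AlgebraicGeometry.Scheme.{0}) [AlgebraicGeometry.IsIntegral X']
      [AlgebraicGeometry.IsIntegral Y] (gY : Y ⟶ AlgebraicGeometry.Spec (.of k))
      [AlgebraicGeometry.Smooth gY] (Φ : X' ⟶ Y) [AlgebraicGeometry.IsFinite Φ] (d : ℕ),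
      topologicalKrullDim X' = d → topologicalKrullDim Y = (d + 1 : ℕ) →
      ∀ y : Y, ∃ U : Y.affineOpens, y ∈ (U : Y.Opens) ∧ (Φ.ker.ideal U).IsPrincipal :=
  Summit.ResolutionOfSingularities.ResolutionOfSingularities.Theorems.WeightedThesis.HypersurfaceModel.stub_imageLocallyPrincipal

/-- STUB M (RESHAPE 4, lead; glue form over stubs A, B, C) — LANDED (p142081, `Theorems/WeightedInvariantWeightedThesisFiniteFieldBranch.lean`): **the finite-field branch — regular, or a hypersurface model up to a
proper birational modification.** For an integral closed `X ⊆ ℙⁿ_k`, `k` perfect of characteristic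
`p`: either `X` is regular (the case `dim X = 0`), or there are an integral `X'`, a proper
birational `ρ : X' → X`, and a finite birational morphism `φ : X' → H` onto an integral closed
subscheme `H`, with locally principal ideal sheaf, of a smooth separated quasi-compact `k`-scheme
`Y` (namely `Y = ℙ^d ×_k ℙ¹`, `X'` the closure of the graph of a primitive element of
`K(X)/K(ℙ^d)` for a finite separable `ψ : X → ℙ^d`). Assembly of stubs K/A, B, C by the lead.
[folklore; cite: Kedlaya2004, Thm 1; Fulton1998, Prop. 1.4 (a) (proof)] -/
theorem stub_finiteFieldBranch_of_parts :
    (∀ (p : ℕ), p.Prime → ∀ (k : Type) [Field k] [CharP k p] [PerfectField k] (n : ℕ)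
      (X : AlgebraicGeometry.Scheme.{0}) [AlgebraicGeometry.IsIntegral X]
      (ι : X ⟶ (Literature.AlgebraicGeometry.Motives.projectiveSpace n k).left)
      [AlgebraicGeometry.IsClosedImmersion ι],
      ∃ (d : ℕ) (ψ : X ⟶ Literature.AlgebraicGeometry.Motives.ProjSpace.P d k)
        (_ : AlgebraicGeometry.IsFinite ψ) (_ : AlgebraicGeometry.Surjective ψ),
        ψ ≫ Literature.AlgebraicGeometry.Motives.Segre.toSpec (Fin (d + 1)) k =
            ι ≫ (Literature.AlgebraicGeometry.Motives.projectiveSpace n k).hom ∧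
        topologicalKrullDim X = d ∧
        ∀ [Algebra (Literature.AlgebraicGeometry.Motives.ProjSpace.P d k).functionField
            X.functionField],
          algebraMap (Literature.AlgebraicGeometry.Motives.ProjSpace.P d k).functionField
              X.functionField = Literature.AlgebraicGeometry.Motives.RatFn.functionFieldMap ψ →
          Algebra.IsSeparable (Literature.AlgebraicGeometry.Motives.ProjSpace.P d k).functionField
              X.functionField ∧
            Module.Finite (Literature.AlgebraicGeometry.Motives.ProjSpace.P d k).functionField
              X.functionField) →
    (∀ (k : Type) [Field k] (X : AlgebraicGeometry.Scheme.{0}) [AlgebraicGeometry.IsIntegral X]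
      [AlgebraicGeometry.IsLocallyNoetherian X] (fX : X ⟶ AlgebraicGeometry.Spec (.of k))
      (w : X.functionField),
      (letI := ((X.presheaf.germ ⊤ (genericPoint X) trivial).hom.comp
          (fX.appTop.hom.comp (AlgebraicGeometry.Scheme.ΓSpecIso (.of k)).inv.hom)).toAlgebra;
        Transcendental k w) →
      ∃ (X' : AlgebraicGeometry.Scheme.{0}) (_ : AlgebraicGeometry.IsIntegral X') (π : X' ⟶ X)
        (_ : AlgebraicGeometry.IsProper π) (_ : AlgebraicGeometry.IsDominant π)
        (ψ : X' ⟶ Literature.AlgebraicGeometry.Motives.ProjSpace.P 1 k)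
        (_ : AlgebraicGeometry.IsDominant ψ)
        (hc : π ≫ fX = ψ ≫ Literature.AlgebraicGeometry.Motives.Segre.toSpec (Fin (1 + 1)) k),
        Literature.AlgebraicGeometry.Resolution.IsBirational π ∧
        AlgebraicGeometry.IsClosedImmersion (CategoryTheory.Limits.pullback.lift π ψ hc) ∧
        Function.Bijective (Literature.AlgebraicGeometry.Motives.RatFn.functionFieldMap π) ∧
        Literature.AlgebraicGeometry.Motives.RatFn.functionFieldMap ψ
            (Literature.AlgebraicGeometry.Motives.ProjLine.t k) =
          Literature.AlgebraicGeometry.Motives.RatFn.functionFieldMap π w) →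
    (∀ (k : Type) [Field k] (X' Y : AlgebraicGeometry.Scheme.{0}) [AlgebraicGeometry.IsIntegral X']
      [AlgebraicGeometry.IsIntegral Y] (gY : Y ⟶ AlgebraicGeometry.Spec (.of k))
      [AlgebraicGeometry.Smooth gY] (Φ : X' ⟶ Y) [AlgebraicGeometry.IsFinite Φ] (d : ℕ),
      topologicalKrullDim X' = d → topologicalKrullDim Y = (d + 1 : ℕ) →
      ∀ y : Y, ∃ U : Y.affineOpens, y ∈ (U : Y.Opens) ∧ (Φ.ker.ideal U).IsPrincipal) →
    ∀ (p : ℕ), p.Prime → ∀ (k : Type) [Field k] [CharP k p] [PerfectField k] (n : ℕ)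
      (X : AlgebraicGeometry.Scheme.{0})
      (ι : X ⟶ (Literature.AlgebraicGeometry.Motives.projectiveSpace n k).left),
      AlgebraicGeometry.IsClosedImmersion ι → AlgebraicGeometry.IsIntegral X →
      Literature.AlgebraicGeometry.Resolution.Scheme.IsRegular X ∨
      ∃ (X' : AlgebraicGeometry.Scheme.{0}) (_ : AlgebraicGeometry.IsIntegral X') (ρ : X' ⟶ X)
        (_ : AlgebraicGeometry.IsProper ρ),
        Literature.AlgebraicGeometry.Resolution.IsBirational ρ ∧
        ∃ (Y H : AlgebraicGeometry.Scheme.{0}) (g : Y ⟶ AlgebraicGeometry.Spec (.of k)) (j : H ⟶ Y)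
          (φ : X' ⟶ H), AlgebraicGeometry.Smooth g ∧ AlgebraicGeometry.IsSeparated g ∧
          AlgebraicGeometry.QuasiCompact g ∧ AlgebraicGeometry.IsClosedImmersion j ∧
          AlgebraicGeometry.IsIntegral H ∧
          (∀ y : Y, ∃ U : Y.affineOpens, y ∈ (U : Y.Opens) ∧ (j.ker.ideal U).IsPrincipal) ∧
          AlgebraicGeometry.IsFinite φ ∧ Literature.AlgebraicGeometry.Resolution.IsBirational φ :=
  Summit.ResolutionOfSingularities.ResolutionOfSingularities.Theorems.WeightedThesis.HypersurfaceModel.stub_finiteFieldBranch_of_parts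

/-- The finite-field branch (stub M fed with stubs A, B, C): regular, or a hypersurface model up to a
proper birational modification. [folklore] -/
theorem finiteFieldBranch :
    ∀ (p : ℕ), p.Prime → ∀ (k : Type) [Field k] [CharP k p] [PerfectField k] (n : ℕ)
      (X : AlgebraicGeometry.Scheme.{0})
      (ι : X ⟶ (Literature.AlgebraicGeometry.Motives.projectiveSpace n k).left),
      AlgebraicGeometry.IsClosedImmersion ι → AlgebraicGeometry.IsIntegral X →
      Literature.AlgebraicGeometry.Resolution.Scheme.IsRegular X ∨
      ∃ (X' : AlgebraicGeometry.Scheme.{0}) (_ : AlgebraicGeometry.IsIntegral X') (ρ : X' ⟶ X)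
        (_ : AlgebraicGeometry.IsProper ρ),
        Literature.AlgebraicGeometry.Resolution.IsBirational ρ ∧
        ∃ (Y H : AlgebraicGeometry.Scheme.{0}) (g : Y ⟶ AlgebraicGeometry.Spec (.of k)) (j : H ⟶ Y)
          (φ : X' ⟶ H), AlgebraicGeometry.Smooth g ∧ AlgebraicGeometry.IsSeparated g ∧
          AlgebraicGeometry.QuasiCompact g ∧ AlgebraicGeometry.IsClosedImmersion j ∧
          AlgebraicGeometry.IsIntegral H ∧
          (∀ y : Y, ∃ U : Y.affineOpens, y ∈ (U : Y.Opens) ∧ (j.ker.ideal U).IsPrincipal) ∧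
          AlgebraicGeometry.IsFinite φ ∧ Literature.AlgebraicGeometry.Resolution.IsBirational φ :=
  stub_finiteFieldBranch_of_parts stub_separableProjection stub_graphClosure stub_imageLocallyPrincipal

/-! ### Landed compositions concluding the crux from the doors (kept OUT of this workfile: the skeleton checker takes any
theorem concluding `WeightedThesis` as a skeleton candidate). In the tree: `weightedThesis_of_hypersurfaceStrategy_of_forall_berghRydh_charP`
(RESHAPE 8, …HypersurfaceStrategyAssembly), `weightedThesis_of_hypersurfaceChoice_of_forall_berghRydh_charP` (9a, …HypersurfaceChoiceTower),
`weightedThesis_of_hypersurfaceChoiceDim_of_forall_berghRydh_charP` (9b, …HypersurfaceChoiceDimTower),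
`weightedThesis_of_hypersurfaceChoiceTDim_of_forall_berghRydh_charP` (10, …HypersurfaceChoiceTTower),
`weightedThesis_of_hypersurfaceTowerChoiceDim_of_forall_berghRydh_charP` (11, …HypersurfaceTowerChoiceTower). -/

/-! ## Composition -/

/-- The line closes the crux modulo its stubs: `WeightedThesis` BY NAME (RESHAPE 8). At a prime `p` and a
perfect field `k` of characteristic `p`: the hypersurface centre STRATEGY of stub S and Bergh–Rydh over `k`
(stub BR-p) resolve every integral hypersurface of every smooth separated quasi-compact `k`-scheme — the cobordant
tower run over hypersurface pairs by well-founded induction on the tower-step relation of the strategy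
(`HypersurfaceStrategyTower.hasResolution_quotient_of_gradedAtlas`: base = regular hypersurface ⇒ quotient
singularities ⇒ Bergh–Rydh; step = regular weighted centre off the generic point, homogeneous on torus charts,
global cobordant blow-up, integral hypersurface strict transform, quotient step, blow-up downstairs) — and the
hypersurface reduction (projective reduction, hypersurface models over infinite and finite perfect fields, finite
birational transfer; all landed by this line) spreads this to every reduced separated `k`-scheme of finite type
(`weightedThesis_of_hypersurfaceStrategy_of_forall_berghRydh_charP`, landed). [folklore] -/
theorem WeightedThesis_of : WeightedThesis :=
  perfectResolution_of_hypersurfaceTowerChoiceDim_of_forall_berghRydh_charP stub_hypersurfaceTowerChoiceDim stub_berghRydh2019_charP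

/-- The RESHAPE 6 composition is a special case: item stmt-0571 and stub BR-p give the crux (through stub S).
[folklore] -/
theorem weightedThesis_of_weightedConstruction (hC : WeightedConstruction) : WeightedThesis :=
  perfectResolution_of_hypersurfaceTowerChoiceDim_of_forall_berghRydh_charP
    (stub_hypersurfaceTowerChoiceDim_of_weightedConstruction hC) stub_berghRydh2019_charP






/-- The hypersurface half of the transfer, by hand: a hypersurface centre strategy resolves every integral
HYPERSURFACE `j : H ⟶ Y` of a smooth separated quasi-compact `Y` over a perfect field of characteristic `p`,
granted Bergh–Rydh over that field. [folklore] -/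
theorem hasResolution_hypersurface_of_hypersurfaceStrategy {p : ℕ} (hp : p.Prime)
    (S : Summit.ResolutionOfSingularities.ResolutionOfSingularities.Theorems.HypersurfaceCentreStrategy p)
    {k : Type} [Field k] [CharP k p] [PerfectField k] {Y X : Scheme.{0}} (f : Y ⟶ Spec (.of k))
    [Smooth f] [IsSeparated f] [QuasiCompact f] (i : X ⟶ Y) [IsClosedImmersion i] [IsIntegral X]
    (hprinc : ∀ y : Y, ∃ U : Y.affineOpens, y ∈ (U : Y.Opens) ∧ (i.ker.ideal U).IsPrincipal) :
    Scheme.HasResolution X :=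
  Summit.ResolutionOfSingularities.ResolutionOfSingularities.Theorems.HypersurfaceStrategyTower.hasResolution_hypersurface_of_strategy_field
    S (fun V g _ _ _ _ hV => stub_berghRydh2019_charP p hp k V g hV) f i
    (Summit.ResolutionOfSingularities.ResolutionOfSingularities.Theorems.isLocallyPrincipal_of_forall_isPrincipal hprinc)

/-- The RESHAPE 7 form by hand: a hypersurface DATUM resolves every integral hypersurface, granted Bergh–Rydh over
the field (now through the strategy it defines). [folklore] -/
theorem hasResolution_hypersurface_of_hypersurfaceDatum {p : ℕ} (hp : p.Prime)
    (D : Summit.ResolutionOfSingularities.ResolutionOfSingularities.Theorems.HypersurfaceResolutionDatum p)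
    {k : Type} [Field k] [CharP k p] [PerfectField k] {Y X : Scheme.{0}} (f : Y ⟶ Spec (.of k))
    [Smooth f] [IsSeparated f] [QuasiCompact f] (i : X ⟶ Y) [IsClosedImmersion i] [IsIntegral X]
    (hprinc : ∀ y : Y, ∃ U : Y.affineOpens, y ∈ (U : Y.Opens) ∧ (i.ker.ideal U).IsPrincipal) :
    Scheme.HasResolution X := by
  obtain ⟨S⟩ := hyp_nonempty_strategy_of_hypersurfaceDatum D
  exact hasResolution_hypersurface_of_hypersurfaceStrategy hp S f i hprinc

/-- RESHAPE 11 bookkeeping: granted stub τ, the crux is EQUIVALENT to stub BR-p (BR-p is implied by the crux outright —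
`berghRydh_field_of_resolution_field` — and gives it back through the tower-indexed ladder tower), so the residue {stub τ, stub BR-p}
cannot be shrunk on the Bergh–Rydh side short of proving the crux. [cite: BerghRydh2019, Thm 5; Wlodarczyk2022, Thm 1.1.6] -/
theorem weightedThesis_iff_stub_berghRydh2019_charP :
    WeightedThesis ↔
    ∀ p : ℕ, p.Prime → ∀ (k : Type) [Field k] [CharP k p] [PerfectField k] (V : AlgebraicGeometry.Scheme.{0}) (g : V ⟶ AlgebraicGeometry.Spec (.of k)) [AlgebraicGeometry.IsIntegral V] [AlgebraicGeometry.IsSeparated g] [AlgebraicGeometry.LocallyOfFiniteType g] [AlgebraicGeometry.QuasiCompact g], (∀ v : V, ∃ (A : Type) (_ : AddCommGroup A) (_ : Finite A) (_ : DecidableEq A) (S : Type) (_ : CommRing S) (_ : Algebra k S) (𝒮 : A → Submodule k S) (_ : GradedAlgebra 𝒮), Algebra.FiniteType k S ∧ Algebra.Smooth k S ∧ ∃ φ : AlgebraicGeometry.Spec (.of (𝒮 0)) ⟶ V, AlgebraicGeometry.Etale φ ∧ v ∈ Set.range φ ∧ φ ≫ g = AlgebraicGeometry.Spec.map (CommRingCat.ofHom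 (algebraMap k (𝒮 0)))) → Literature.AlgebraicGeometry.Resolution.Scheme.HasResolution V := by
  constructor
  · intro hT p hp k _ _ _ V g _ _ _ _ hV
    exact Summit.ResolutionOfSingularities.ResolutionOfSingularities.Theorems.WeightedThesis.BerghRydhCharP.berghRydh_field_of_resolution_field
      (fun X f hs hl hq hr => hT p hp k X f hs hl hq hr) V g hV
  · intro hBR p hp k _ _ _ X f hs hl hq hr
    exact perfectResolution_of_hypersurfaceTowerChoiceDim_of_forall_berghRydh_charP stub_hypersurfaceTowerChoiceDim hBR p hp k X f hs hl hq hr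

end Summit.ResolutionOfSingularities.ResolutionOfSingularities.Cruxes.WeightedThesis.Lines.DatumGluedSplit

end
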